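import Summits.Ventures.HodgeKum4.Theorems.KummerFixedLocusDefs
import Literature.AlgebraicGeometry.Hyperkaehler.GeneralizedKummerTypeTranslationGroup
import Literature.AlgebraicGeometry.Hyperkaehler.LLVStructureKummerType
import Literature.AlgebraicGeometry.Hyperkaehler.LLVTrivialClassesHodgeType
import Literature.AlgebraicTopology.SingularHomology.IntegralClassRingChange
import HarnessLib

/-!
# `Γ`-coinvariant middle classes of a `Kum⁴`-type variety are LLV-trivial, hence of type `(4,4)`
(cell `hodge-kum4`, seat p2; leaf A4 of crux I)

HONEST FRAMING.  PROVED modulo the landed named facts `Foster2024_translationAction_kum4Type`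
(clause (ii): `Γ(X)` acts trivially on `Hᵏ(X(ℂ); ℂ)` for `k ≠ 8`) and, for the Hodge-type
corollary, `GreenKimLazaRobles2022_llvTrivial_isOfHodgeType_kumType`; uses the PROVED uniqueness of
dual Lefschetz operators `IsDualLefschetz.unique` (Looijenga–Lunts §1).

For `X` smooth projective of dimension `8` of `Kum⁴`-type and `𝒦 ⊂ H⁸(X(ℂ); ℂ)` the augmentation
submodule of `Γ(X)` (`Representation.Coinvariants.ker (translationRep X 8)`):

* `totalRep g` — the total action `T_g = ⨁ₖ ρₖ(g)` of `g ∈ Γ(X)` on `H*(X(ℂ); ℂ)`; it commutes with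
  the degree operator `h`, with every Lefschetz operator `L_a` (`Γ` fixes `H²`, pull-back is
  multiplicative), hence — by uniqueness of `sl(2)`-partners — with every dual Lefschetz operator `Λ`
  (Markman's remark: "`Γ` commutes with `g(Y)` since `Γ` acts trivially on `H²` and `f_a` is
  uniquely determined by `e_a`");
* `T_g u - u ∈ 𝒦_tot := ofDegree 8 (𝒦)` for every `u ∈ H*` (off-middle triviality), so `Λ`
  preserves `𝒦_tot`; `h = 0` and `L_a = 0` on `𝒦_tot` (degree `8 - 8 = 0`; `H² ∪ 𝒦 = 0`);
  from `⁅h, Λ⁆ = -2Λ` then `Λ = 0` on `𝒦_tot`;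
* the annihilator of `𝒦_tot` is a Lie subalgebra containing all generators of `g_tot`, so
  `𝒦 ⊆` LLV-trivial classes (`isLLVTrivial_of_mem_coinvariantsKer`), and by GKLR Prop. 21 / Rem. 33
  every class of `𝒦` (and the complexification of every class of `𝒦ℝ`) is of Hodge type `(4,4)`
  (`isOfHodgeType_of_mem_coinvariantsKer`, `isOfHodgeType_ringChange_of_mem_coinvariantsKer`) — the
  Hodge-type hypothesis of the Hodge–Riemann record `Voisin2002_hodgeIndex_hodgeRiemann_middle.dim8`.
-/

noncomputable section

open DirectSum CategoryTheory
open Literature.AlgebraicTopology.SingularHomology singularCochainComplex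
open Literature.AlgebraicGeometry Literature.AlgebraicGeometry.HodgeTheory
open Literature.AlgebraicGeometry.Hyperkaehler
open Literature.Geometry.Kaehler

attribute [local instance 100] LieRing.ofAssociativeRing

namespace Summit.Ventures.HodgeKum4

variable {X : Motives.SchemeOver ℂ}

/-! ### `H² ∪ 𝒦 = 0` (Literature vocabulary) -/

/-- For `g ∈ Γ(X)`, `ρ(g) = (g⁻¹)^*` is multiplicative and fixes `H²`:
`e ∪ ρ(g)v = (g⁻¹)^*(e ∪ v)`. -/
theorem cup_translationRep {k l : ℕ} (h : 2 + k = l) (g : Hyperkaehler.autFixingH2H3 X) (e : complexBetti X 2)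
    (v : complexBetti X k) :
    cupProduct (R := ℂ) (X := Motives.ComplexPoints X) h e (translationRep X k g v) =
      (complexBetti.map (g⁻¹ : Hyperkaehler.autFixingH2H3 X).val.hom l).hom
        (cupProduct (R := ℂ) (X := Motives.ComplexPoints X) h e v) := by
  have H := cupProduct_map (R := ℂ)
    (Motives.AlgPoints.mapContinuous (L := ℂ) (g⁻¹ : Hyperkaehler.autFixingH2H3 X).val.hom) h e v
  have he : singularCohomology.map ℂ ℂ
      (Motives.AlgPoints.mapContinuous (L := ℂ) (g⁻¹ : Hyperkaehler.autFixingH2H3 X).val.hom) 2 e = e := by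
    have h2 := ((Hyperkaehler.mem_autFixingH2H3_iff _).1 (g⁻¹).2).1
    change (complexBetti.map (g⁻¹ : Hyperkaehler.autFixingH2H3 X).val.hom 2).hom e = e
    rw [h2]
    rfl
  rw [he] at H
  rw [translationRep_apply]
  exact H.symm

/-- **`H² ∪ 𝒦 = 0`**: every class of the augmentation submodule `𝒦 ⊂ H⁸(X(ℂ); ℂ)` is killed by
cup product with `H²(X(ℂ); ℂ)`, granted `Foster2024_translationAction_kum4Type` (clause (ii) in the
target degree `l = 10 ≠ 8`). -/
theorem cup_eq_zero_of_mem_coinvariantsKer_translationRep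
    (hF : Foster2024_translationAction_kum4Type)
    (hX : Motives.IsSmoothProjective 8 X) (hK : IsOfGeneralizedKummerType 4 X)
    {l : ℕ} (h : 2 + 8 = l) (e : complexBetti X 2) {x : complexBetti X 8}
    (hx : x ∈ Representation.Coinvariants.ker (translationRep X 8)) :
    cupProduct (R := ℂ) (X := Motives.ComplexPoints X) h e x = 0 := by
  unfold Representation.Coinvariants.ker at hx
  induction hx using Submodule.span_induction with
  | mem y hy =>
    obtain ⟨⟨g, v⟩, rfl⟩ := hy
    change cupProduct h e (translationRep X 8 g v - v) = 0
    rw [map_sub, cup_translationRep, sub_eq_zero]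
    have hl : l ≠ 8 := by omega
    rw [(hF hX hK).2.2 l hl _ (g⁻¹).2]
    rfl
  | zero => exact map_zero _
  | add a b _ _ ha hb => rw [map_add, ha, hb, add_zero]
  | smul c a _ ha => rw [map_smul, ha, smul_zero]

/-- `ℝ`-linearity of complexification: `(r • x) ⊗ 1 = r • (x ⊗ 1)`. -/
theorem ringChange_real_smul {Y : Type} [TopologicalSpace Y] {k : ℕ} (r : ℝ)
    (x : singularCohomology ℝ ℝ Y k) :
    singularCohomology.ringChange (algebraMap ℝ ℂ) Y k (r • x) =
      (r : ℂ) • singularCohomology.ringChange (algebraMap ℝ ℂ) Y k x := by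
  induction x using singularCohomology_induction_on with
  | h ζ =>
    rw [← map_smul, singularCohomology.ringChange_π, singularCohomology.ringChange_π, ← map_smul]
    congr 1
    refine coFn_injective ?_
    have h1 : coFn (r • ζ) = r • coFn ζ := (iCocycles ℝ ℝ Y k).hom.map_smul r ζ
    have h2 : coFn ((r : ℂ) • cocyclesRingChange (algebraMap ℝ ℂ) k ζ) =
        (r : ℂ) • coFn (cocyclesRingChange (algebraMap ℝ ℂ) k ζ) :=
      (iCocycles ℂ ℂ Y k).hom.map_smul (r : ℂ) _
    rw [coFn_cocyclesRingChange, h1, h2, coFn_cocyclesRingChange]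
    funext σ
    simp only [Function.comp_apply, Pi.smul_apply, smul_eq_mul, map_mul]
    rfl


/-- Complexification maps the real augmentation submodule `𝒦ℝ` into `𝒦`. -/
theorem ringChange_mem_coinvariantsKer {x : singularCohomology ℝ ℝ (Motives.ComplexPoints X) 8}
    (hx : x ∈ Representation.Coinvariants.ker (translationRepReal X 8)) :
    singularCohomology.ringChange (algebraMap ℝ ℂ) (Motives.ComplexPoints X) 8 x ∈
      Representation.Coinvariants.ker (translationRep X 8) := by
  unfold Representation.Coinvariants.ker at hx ⊢
  induction hx using Submodule.span_induction with
  | mem y hy =>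
    obtain ⟨⟨g, v⟩, rfl⟩ := hy
    change singularCohomology.ringChange (algebraMap ℝ ℂ) _ 8 (translationRepReal X 8 g v - v) ∈ _
    rw [map_sub, translationRepReal_apply]
    refine Submodule.subset_span ⟨(g, singularCohomology.ringChange (algebraMap ℝ ℂ) _ 8 v), ?_⟩
    change translationRep X 8 g _ - _ = _
    rw [translationRep_apply]
    congr 1
    exact (singularCohomology.ringChange_map (algebraMap ℝ ℂ) _ v).symm
  | zero => rw [map_zero]; exact Submodule.zero_mem _
  | add a b _ _ ha hb => rw [map_add]; exact Submodule.add_mem _ ha hb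
  | smul c a _ ha => rw [ringChange_real_smul]; exact Submodule.smul_mem _ _ ha

/-! ### The total action of `Γ(X)` on `H*(X(ℂ); ℂ)` -/

/-- `T_g` on a homogeneous class: `T_g (x)ₖ = (ρₖ(g) x)ₖ`. -/
@[simp]
theorem totalRep_lof (g : Hyperkaehler.autFixingH2H3 X) (k : ℕ) (x : complexBetti X k) :
    totalRep g (ofDegree ℂ (Motives.ComplexPoints X) k x) =
      ofDegree ℂ (Motives.ComplexPoints X) k (translationRep X k g x) := by
  simp only [totalRep, toModule_lof, LinearMap.coe_comp, Function.comp_apply]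

/-- `T_1 = 1`. -/
theorem totalRep_one : totalRep (1 : Hyperkaehler.autFixingH2H3 X) = 1 := by
  refine linearMap_ext ℂ fun k ↦ LinearMap.ext fun x ↦ ?_
  simp only [LinearMap.coe_comp, Function.comp_apply, totalRep_lof, map_one, Module.End.one_apply]

/-- `T_{gh} = T_g T_h`. -/
theorem totalRep_mul (g h : Hyperkaehler.autFixingH2H3 X) : totalRep (g * h) = totalRep g * totalRep h := by
  refine linearMap_ext ℂ fun k ↦ LinearMap.ext fun x ↦ ?_
  simp only [LinearMap.coe_comp, Function.comp_apply, Module.End.mul_apply, totalRep_lof, map_mul]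

/-- `T_g T_{g⁻¹} = 1`. -/
theorem totalRep_mul_inv (g : Hyperkaehler.autFixingH2H3 X) : totalRep g * totalRep g⁻¹ = 1 := by
  rw [← totalRep_mul, mul_inv_cancel, totalRep_one]

/-- `T_{g⁻¹} T_g = 1`. -/
theorem totalRep_inv_mul (g : Hyperkaehler.autFixingH2H3 X) : totalRep g⁻¹ * totalRep g = 1 := by
  rw [← totalRep_mul, inv_mul_cancel, totalRep_one]

/-- `T_g` commutes with the degree operator `h` (it preserves degrees). -/
theorem degreeOperator_mul_totalRep (N : ℕ) (g : Hyperkaehler.autFixingH2H3 X) :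
    degreeOperator ℂ (Motives.ComplexPoints X) N * totalRep g =
      totalRep g * degreeOperator ℂ (Motives.ComplexPoints X) N := by
  refine linearMap_ext ℂ fun k ↦ LinearMap.ext fun x ↦ ?_
  simp only [LinearMap.coe_comp, Function.comp_apply, Module.End.mul_apply, totalRep_lof,
    degreeOperator_lof, map_smul]

/-- `T_g` commutes with every Lefschetz operator `L_a` (`Γ` fixes `H²` and pull-back is
multiplicative). -/
theorem totalLefschetz_mul_totalRep (g : Hyperkaehler.autFixingH2H3 X) (a : complexBetti X 2) :
    totalLefschetz a * totalRep g = totalRep g * totalLefschetz a := by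
  refine linearMap_ext ℂ fun k ↦ LinearMap.ext fun x ↦ ?_
  simp only [LinearMap.coe_comp, Function.comp_apply, Module.End.mul_apply, totalRep_lof,
    totalLefschetz_lof, lefschetzOperator_apply]
  rw [cup_translationRep (Nat.add_comm 2 k) g a x, translationRep_apply]

/-- Conjugation by `T_g` preserves dual Lefschetz operators: if `(L_a, h, Λ)` is an `sl(2)`-triple
so is `(L_a, h, T_g Λ T_g⁻¹)`. -/
theorem isDualLefschetz_conj {N : ℕ} {a : complexBetti X 2}
    {Λ : Module.End ℂ (totalCohomology ℂ (Motives.ComplexPoints X))} (hΛ : IsDualLefschetz N a Λ)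
    (g : Hyperkaehler.autFixingH2H3 X) : IsDualLefschetz N a (totalRep g * Λ * totalRep g⁻¹) := by
  have hTS := totalRep_mul_inv (X := X) g
  have heT := totalLefschetz_mul_totalRep g a
  have heS := totalLefschetz_mul_totalRep g⁻¹ a
  have hhT := degreeOperator_mul_totalRep (X := X) N g
  have hhS := degreeOperator_mul_totalRep (X := X) N g⁻¹
  refine ⟨hΛ.h_ne_zero, ?_, lie_degreeOperator_totalLefschetz N a, ?_⟩
  · have e1 : ⁅totalLefschetz a, totalRep g * Λ * totalRep g⁻¹⁆ =
        totalRep g * ⁅totalLefschetz a, Λ⁆ * totalRep g⁻¹ := by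
      rw [Ring.lie_def, Ring.lie_def, mul_sub, sub_mul, ← mul_assoc, ← mul_assoc, heT,
        mul_assoc (totalRep g * Λ) (totalRep g⁻¹) (totalLefschetz a), ← heS]
      simp only [mul_assoc]
    rw [e1, hΛ.lie_e_f, ← hhT, mul_assoc, hTS, mul_one]
  · have e1 : ⁅degreeOperator ℂ (Motives.ComplexPoints X) N, totalRep g * Λ * totalRep g⁻¹⁆ =
        totalRep g * ⁅degreeOperator ℂ (Motives.ComplexPoints X) N, Λ⁆ * totalRep g⁻¹ := by
      rw [Ring.lie_def, Ring.lie_def, mul_sub, sub_mul, ← mul_assoc, ← mul_assoc, hhT,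
        mul_assoc (totalRep g * Λ) (totalRep g⁻¹) (degreeOperator ℂ _ N), ← hhS]
      simp only [mul_assoc]
    have e2 : ∀ P Q : Module.End ℂ (totalCohomology ℂ (Motives.ComplexPoints X)),
        totalRep g * (P - Q) * totalRep g⁻¹ =
          totalRep g * P * totalRep g⁻¹ - totalRep g * Q * totalRep g⁻¹ := fun P Q ↦ by
      rw [mul_sub, sub_mul]
    -- `⁅h, Λ⁆ = -(2 • Λ) = 0 - (Λ + Λ)`
    have e3 : ⁅degreeOperator ℂ (Motives.ComplexPoints X) N, Λ⁆ = 0 - (Λ + Λ) := by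
      rw [hΛ.lie_h_f_nsmul, two_nsmul, zero_sub]
    rw [e1, e3, e2, mul_zero, zero_mul, mul_add, add_mul, zero_sub, two_nsmul]

/-- **`Γ(X)` commutes with the LLV algebra generators**: `T_g Λ = Λ T_g` for every dual Lefschetz
operator `Λ` (uniqueness of `sl(2)`-partners, `IsDualLefschetz.unique`). -/
theorem totalRep_mul_dual (hX : Motives.IsSmoothProjective 8 X) {N : ℕ} {a : complexBetti X 2}
    {Λ : Module.End ℂ (totalCohomology ℂ (Motives.ComplexPoints X))} (hΛ : IsDualLefschetz N a Λ)
    (g : Hyperkaehler.autFixingH2H3 X) : totalRep g * Λ = Λ * totalRep g := by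
  have h := IsDualLefschetz.unique hX hΛ (isDualLefschetz_conj hΛ g)
  calc totalRep g * Λ = totalRep g * Λ * (totalRep g⁻¹ * totalRep g) := by
          rw [totalRep_inv_mul, mul_one]
    _ = (totalRep g * Λ * totalRep g⁻¹) * totalRep g := by rw [← mul_assoc]
    _ = Λ * totalRep g := by rw [← h]

/-! ### The total augmentation submodule `𝒦_tot` -/

/-- The degree operator (complex dimension `8`) kills `𝒦_tot` (degree `8 - 8 = 0`). -/
theorem degreeOperator_apply_of_mem {w : totalCohomology ℂ (Motives.ComplexPoints X)}
    (hw : w ∈ coinvariantsKerTotal X) : degreeOperator ℂ (Motives.ComplexPoints X) 8 w = 0 := by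
  obtain ⟨y, -, rfl⟩ := hw
  rw [degreeOperator_lof, sub_self, zero_smul]

/-- Every Lefschetz operator kills `𝒦_tot` (`H² ∪ 𝒦 = 0`). -/
theorem totalLefschetz_apply_of_mem (hF : Foster2024_translationAction_kum4Type)
    (hX : Motives.IsSmoothProjective 8 X) (hK : IsOfGeneralizedKummerType 4 X)
    (a : complexBetti X 2) {w : totalCohomology ℂ (Motives.ComplexPoints X)}
    (hw : w ∈ coinvariantsKerTotal X) : totalLefschetz a w = 0 := by
  obtain ⟨y, hy, rfl⟩ := hw
  rw [totalLefschetz_lof, lefschetzOperator_apply,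
    cup_eq_zero_of_mem_coinvariantsKer_translationRep hF hX hK (Nat.add_comm 2 8) a hy, map_zero]

/-- Off-middle triviality: `T_g u - u ∈ 𝒦_tot` for every `u ∈ H*(X(ℂ); ℂ)` and `g ∈ Γ(X)`. -/
theorem totalRep_sub_mem (hF : Foster2024_translationAction_kum4Type)
    (hX : Motives.IsSmoothProjective 8 X) (hK : IsOfGeneralizedKummerType 4 X)
    (g : Hyperkaehler.autFixingH2H3 X) (u : totalCohomology ℂ (Motives.ComplexPoints X)) :
    totalRep g u - u ∈ coinvariantsKerTotal X := by
  suffices H : (coinvariantsKerTotal X).mkQ ∘ₗ (totalRep g - 1) = 0 by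
    have := LinearMap.congr_fun H u
    simpa only [LinearMap.coe_comp, Function.comp_apply, LinearMap.sub_apply, Module.End.one_apply,
      Submodule.mkQ_apply, LinearMap.zero_apply, Submodule.Quotient.mk_eq_zero] using this
  refine linearMap_ext ℂ fun k ↦ LinearMap.ext fun x ↦ ?_
  simp only [LinearMap.coe_comp, Function.comp_apply, LinearMap.sub_apply, Module.End.one_apply,
    totalRep_lof, LinearMap.zero_comp, LinearMap.zero_apply, Submodule.mkQ_apply,
    Submodule.Quotient.mk_eq_zero]
  by_cases hk : k = 8
  · subst hk
    rw [← map_sub]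
    exact Submodule.mem_map_of_mem
      (Representation.Coinvariants.mem_ker_of_eq (ρ := translationRep X 8) g x _ rfl)
  · rw [Foster2024_translationAction_kum4Type.translationRep_apply_of_ne hF hX hK hk, sub_self]
    exact Submodule.zero_mem _

/-- Every dual Lefschetz operator preserves `𝒦_tot` (it commutes with `Γ(X)`). -/
theorem dual_apply_mem (hF : Foster2024_translationAction_kum4Type)
    (hX : Motives.IsSmoothProjective 8 X) (hK : IsOfGeneralizedKummerType 4 X)
    {N : ℕ} {a : complexBetti X 2} {Λ : Module.End ℂ (totalCohomology ℂ (Motives.ComplexPoints X))}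
    (hΛ : IsDualLefschetz N a Λ) {w : totalCohomology ℂ (Motives.ComplexPoints X)}
    (hw : w ∈ coinvariantsKerTotal X) : Λ w ∈ coinvariantsKerTotal X := by
  obtain ⟨y, hy, rfl⟩ := hw
  unfold Representation.Coinvariants.ker at hy
  induction hy using Submodule.span_induction with
  | mem y hy =>
    obtain ⟨⟨g, v⟩, rfl⟩ := hy
    change Λ (ofDegree ℂ _ 8 (translationRep X 8 g v - v)) ∈ _
    rw [map_sub, ← totalRep_lof, map_sub, ← Module.End.mul_apply, ← totalRep_mul_dual hX hΛ g,
      Module.End.mul_apply]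
    exact totalRep_sub_mem hF hX hK g _
  | zero => rw [map_zero, map_zero]; exact Submodule.zero_mem _
  | add a b _ _ ha hb => rw [map_add, map_add]; exact Submodule.add_mem _ ha hb
  | smul c a _ ha => rw [map_smul, map_smul]; exact Submodule.smul_mem _ _ ha

/-- Every dual Lefschetz operator (complex dimension `8`) kills `𝒦_tot`: from `⁅h, Λ⁆ = -2Λ` and
`h = 0` on the `Λ`-stable subspace `𝒦_tot`. -/
theorem dual_apply_of_mem (hF : Foster2024_translationAction_kum4Type)
    (hX : Motives.IsSmoothProjective 8 X) (hK : IsOfGeneralizedKummerType 4 X)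
    {a : complexBetti X 2} {Λ : Module.End ℂ (totalCohomology ℂ (Motives.ComplexPoints X))}
    (hΛ : IsDualLefschetz 8 a Λ) {w : totalCohomology ℂ (Motives.ComplexPoints X)}
    (hw : w ∈ coinvariantsKerTotal X) : Λ w = 0 := by
  have h2 := LinearMap.congr_fun hΛ.lie_h_f_nsmul w
  rw [Ring.lie_def, LinearMap.sub_apply, Module.End.mul_apply, Module.End.mul_apply,
    degreeOperator_apply_of_mem hw, map_zero, sub_zero,
    degreeOperator_apply_of_mem (dual_apply_mem hF hX hK hΛ hw), LinearMap.neg_apply,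
    LinearMap.smul_apply, eq_comm, neg_eq_zero, two_nsmul] at h2
  -- `h2 : Λ w + Λ w = 0`
  have h3 : (2 : ℂ) • Λ w = 0 := by rw [two_smul]; exact h2
  exact (smul_eq_zero.mp h3).resolve_left two_ne_zero

/-! ### The annihilator Lie subalgebra and the conclusion -/

/-- **The LLV algebra kills `𝒦_tot`**: `g_tot(X(ℂ); ℂ)` (complex dimension `8`) is contained in
the annihilator of `𝒦_tot` — all its generators `L_a`, `Λ` are. -/
theorem llvAlgebra_le_annihilator (hF : Foster2024_translationAction_kum4Type)
    (hX : Motives.IsSmoothProjective 8 X) (hK : IsOfGeneralizedKummerType 4 X) :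
    llvAlgebra ℂ (Motives.ComplexPoints X) 8 ≤ annihilatorLieSubalgebra (coinvariantsKerTotal X) := by
  rw [llvAlgebra, LieSubalgebra.lieSpan_le]
  rintro E ⟨a, Λ, hΛ, rfl | rfl⟩
  · exact fun w hw ↦ totalLefschetz_apply_of_mem hF hX hK a hw
  · exact fun w hw ↦ dual_apply_of_mem hF hX hK hΛ hw

/-- **`𝒦 ⊆` LLV-trivial classes**: every class of the augmentation submodule `𝒦 ⊂ H⁸(X(ℂ); ℂ)`
of a smooth projective `Kum⁴`-type variety is killed by the whole LLV algebra
(granted `Foster2024_translationAction_kum4Type`). -/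
theorem isLLVTrivial_of_mem_coinvariantsKer (hF : Foster2024_translationAction_kum4Type)
    (hX : Motives.IsSmoothProjective 8 X) (hK : IsOfGeneralizedKummerType 4 X)
    {y : complexBetti X 8} (hy : y ∈ Representation.Coinvariants.ker (translationRep X 8)) :
    IsLLVTrivial ℂ (Motives.ComplexPoints X) 8 (ofDegree ℂ (Motives.ComplexPoints X) 8 y) :=
  fun _ hE ↦ llvAlgebra_le_annihilator hF hX hK hE _ (Submodule.mem_map_of_mem hy)

/-- **Classes of `𝒦` are of Hodge type `(4,4)`** (granted `Foster2024_translationAction_kum4Type`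
and `GreenKimLazaRobles2022_llvTrivial_isOfHodgeType_kumType`). -/
theorem isOfHodgeType_of_mem_coinvariantsKer
    (hG : GreenKimLazaRobles2022_llvTrivial_isOfHodgeType_kumType)
    (hF : Foster2024_translationAction_kum4Type)
    (hX : Motives.IsSmoothProjective 8 X) (hK : IsOfGeneralizedKummerType 4 X)
    {y : complexBetti X 8} (hy : y ∈ Representation.Coinvariants.ker (translationRep X 8)) :
    IsOfHodgeType 8 X 8 4 4 y :=
  hG.kum4Type hX hK y (isLLVTrivial_of_mem_coinvariantsKer hF hX hK hy)

/-- **Complexified classes of `𝒦ℝ` are of Hodge type `(4,4)`** — the literal Hodge-type hypothesis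
of `Voisin2002_hodgeIndex_hodgeRiemann_middle.dim8` for real `Γ`-coinvariant middle classes. -/
theorem isOfHodgeType_ringChange_of_mem_coinvariantsKer
    (hG : GreenKimLazaRobles2022_llvTrivial_isOfHodgeType_kumType)
    (hF : Foster2024_translationAction_kum4Type)
    (hX : Motives.IsSmoothProjective 8 X) (hK : IsOfGeneralizedKummerType 4 X)
    {x : singularCohomology ℝ ℝ (Motives.ComplexPoints X) 8}
    (hx : x ∈ Representation.Coinvariants.ker (translationRepReal X 8)) :
    IsOfHodgeType 8 X 8 4 4
      (singularCohomology.ringChange (algebraMap ℝ ℂ) (Motives.ComplexPoints X) 8 x) :=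
  isOfHodgeType_of_mem_coinvariantsKer hG hF hX hK (ringChange_mem_coinvariantsKer hx)

/-- **`H² ∪ (𝒦ℝ ⊗ 1) = 0`** — the literal primitivity hypothesis of
`Voisin2002_hodgeIndex_hodgeRiemann_middle.dim8` for real `Γ`-coinvariant middle classes. -/
theorem cup_ringChange_eq_zero_of_mem_coinvariantsKer (hF : Foster2024_translationAction_kum4Type)
    (hX : Motives.IsSmoothProjective 8 X) (hK : IsOfGeneralizedKummerType 4 X)
    {x : singularCohomology ℝ ℝ (Motives.ComplexPoints X) 8}
    (hx : x ∈ Representation.Coinvariants.ker (translationRepReal X 8))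
    (e : singularCohomology ℂ ℂ (Motives.ComplexPoints X) 2) :
    cupProduct (R := ℂ) (X := Motives.ComplexPoints X) (rfl : 2 + 8 = 10) e
      (singularCohomology.ringChange (algebraMap ℝ ℂ) (Motives.ComplexPoints X) 8 x) = 0 :=
  cup_eq_zero_of_mem_coinvariantsKer_translationRep hF hX hK rfl e (ringChange_mem_coinvariantsKer hx)

end Summit.Ventures.HodgeKum4

end
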